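import Literature.AlgebraicGeometry.ModuliOfAbelianVarieties.SiegelFineModuliSchemeClassifyCoequalKernelPair
import HarnessLib

/-!
# The level-descent action of `K_δ(N₀)` on `A_{g,δ,N}` is the action of a FINITE group
# ([MFK94] Ch. 7 §3 p. 140, Lemma 7.11; [Deligne 1971] 4.16)

Topic `AlgebraicGeometry/ModuliOfAbelianVarieties`; namespace
`Literature.AlgebraicGeometry.ModuliOfAbelianVarieties.SiegelFineModuliScheme`.  THEOREMS ONLY (no definition, no named
fact, no instance, no notation, no `sorry`; net Literature debt 0).  Cell hodgecm-mathlib (D-0151), F-DAG leaf F-10 (b)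
«`classify` for the quotient `M/Γ`», brick (Q-lite): the junction between ★ `SiegelFineModuliSchemeLevelGroupAction`
(`exists_principalLevelSubgroup_one_action`: `ρ : K_δ(1) → Aut M` through the reduction `red`, `(ρ γ)⁻¹ = T_{red γ}`,
trivial on `K_δ(N)`) and the tree's finite-quotient theory (`Motives.finiteQuotient` of an `ActionOver` of a FINITE
group): `ρ|_{K_δ(N₀)}` factors through the finite subgroup `Δ = red(K_δ(N₀)) ≤ GL_{2g}(ℤ/N)` ([MumfordFogartyKirwan1994]
p. 140: `Γ ⊆ GL(2g; ℤ/n)` is finite; [Deligne1971TravauxShimura] 4.16: `K/K_n`), and every `act`-invariant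
`p : M → Q` satisfies the hypothesis `hp` of ★ `existsUnique_desc_classifyingMap_left_comp` / ★
`exists_desc_classifyingMap` (via ★ `twist_left_comp_eq_of_forall_inv_left_comp_eq`).  The quotient `M → M/Δ` itself is
downstream (F-10 (Q)).  HC_CM is proved only modulo the 7 printed citations until rung 0 closes; this file discharges
none of them (count-neutral capital).

* **`exists_levelKernel_finite_action`** — `∃ red Δ (act : Δ →* Aut M)`, residue clause for `red`, `red(K_δ(N₀)) ⊆ Δ`
  and `Δ ⊆ red(K_δ(N₀))`, the operator clause `(act (red γ))⁻¹ = classifyingMap (𝒰 · red γ)`, and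
  `(∀ x, act x ≫ p = p) → hp`.

Mathlib searched (pin): `Subgroup.map/comap`, `Subgroup.mem_map`, `MonoidHom` structure literal, `map_inv`,
`inv_mul_eq_one` (all used).

## References
* D. Mumford, J. Fogarty, F. Kirwan, *Geometric Invariant Theory*, 3rd ed. (1994), Ch. 7 §3 (p. 140), Lemma 7.11 (p. 140).
  [MumfordFogartyKirwan1994]
* P. Deligne, *Travaux de Shimura*, Sém. Bourbaki 389 (1971), 4.16 p. 150. [Deligne1971TravauxShimura]
-/

noncomputable section

open CategoryTheory CategoryTheory.Limits AlgebraicGeometry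

namespace Literature.AlgebraicGeometry.ModuliOfAbelianVarieties

open Literature.AlgebraicGeometry.Motives (SchemeOver)
open Literature.AlgebraicGeometry.AbelianSchemes (PolarizedAbelianSchemeWithLevel)
open Literature.AlgebraicGeometry.AbelianSchemes.AbelianSchemeOver
open Literature.NumberTheory.Adeles NumberField IsDedekindDomain

namespace SiegelFineModuliScheme

variable {g N : ℕ} {δ : Fin g → ℕ} (𝓜 : SiegelFineModuliScheme g N δ) [IsCommMonObj 𝓜.univ.A.X] [NeZero N]

/-- **THE LEVEL-DESCENT ACTION IS AN ACTION OF A FINITE GROUP** ([MumfordFogartyKirwan1994] Ch. 7 §3 p. 140 and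
Lemma 7.11: the FINITE group `Γ = Γ_{N₀}^{(d)} = ker(GL_{2g}(ℤ/N) → GL_{2g}(ℤ/N₀))` acts on `𝒜_{g,d,N}`, hence on
`A_{g,d,N}`; [Deligne1971TravauxShimura] 4.16: `_{K}M = _{K_n}M/(K/K_n)`).  The action `ρ : K_δ(1) → Aut M` of ★
`exists_principalLevelSubgroup_one_action` (through the reduction `red : K_δ(1) → GL_{2g}(ℤ/N)`, `(ρ γ)⁻¹ = T_{red γ}`,
trivial on `K_δ(N) = ker red`) restricted to `K_δ(N₀)` FACTORS through the finite subgroup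
`Δ := red(K_δ(N₀)) ≤ GL_{2g}(ℤ/N)`: there is `act : Δ →* Aut M` with `act (red γ) = ρ γ` (so `(act (red γ))⁻¹` is the
twist operator `T_{red γ}`), and every morphism `p : M → Q` invariant under `act` satisfies the hypothesis `hp` of ★
`existsUnique_desc_classifyingMap_left_comp` / ★ `exists_desc_classifyingMap` (★ `twist_left_comp_eq_of_forall_inv_left_comp_eq`).
The quotient `M → M/Δ` (the tree's `Motives.finiteQuotient` of the `ActionOver` attached to `act`) is thus the `p` of
F-10 (b); it is not constructed here. [cite: MumfordFogartyKirwan1994, Ch. 7 §3 (p. 140) and Lemma 7.11 (p. 140)]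
[cite: Deligne1971TravauxShimura, 4.16 p. 150] -/
theorem exists_levelKernel_finite_action (hδ : IsPolarizationType δ) (hg : 0 < g) (N₀ : ℕ) :
    ∃ (red : principalLevelSubgroup δ 1 →* GL (Fin g ⊕ Fin g) (ZMod N))
      (Δ : Subgroup (GL (Fin g ⊕ Fin g) (ZMod N))) (act : Δ →* Aut 𝓜.M),
      (∀ (k : principalLevelSubgroup δ 1) (i j : Fin g ⊕ Fin g)
          (h : (((k : gspFinAdelic δ) : GL (Fin g ⊕ Fin g) finAdeleQ) :
            Matrix (Fin g ⊕ Fin g) (Fin g ⊕ Fin g) finAdeleQ) i j ∈ FiniteAdeleRing.integralAdeles (𝓞 ℚ) ℚ),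
          ((red k : GL (Fin g ⊕ Fin g) (ZMod N)) : Matrix (Fin g ⊕ Fin g) (Fin g ⊕ Fin g) (ZMod N)) i j =
            integralAdeleResidue N ⟨_, h⟩) ∧
      (∀ k : principalLevelSubgroup δ 1, (k : gspFinAdelic δ) ∈ principalLevelSubgroup δ N₀ → red k ∈ Δ) ∧
      (∀ x : Δ, ∃ k : principalLevelSubgroup δ 1, (k : gspFinAdelic δ) ∈ principalLevelSubgroup δ N₀ ∧ red k = x) ∧
      (∀ (k : principalLevelSubgroup δ 1) (hk : red k ∈ Δ),
        ∃ hs : (𝓜.univ.level.twist (red k)).IsSymplecticLiftable 𝓜.univ.pol δ,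
          (act ⟨red k, hk⟩).inv = (haveI := 𝓜.isLocallyNoetherian
            𝓜.classifyingMap 𝓜.M ({ 𝓜.univ with level := 𝓜.univ.level.twist (red k), symplectic := hs } :
              PolarizedAbelianSchemeWithLevel g N δ 𝓜.M.left))) ∧
      ∀ {Q : Scheme} (p : 𝓜.M.left ⟶ Q), (∀ x : Δ, (act x).hom.left ≫ p = p) →
        ∀ r : gspFinAdelic δ, r ∈ principalLevelSubgroup δ N₀ → ∀ GN : GL (Fin g ⊕ Fin g) (ZMod N),
          (∀ (i j : Fin g ⊕ Fin g)
            (h : ((r : GL (Fin g ⊕ Fin g) finAdeleQ) : Matrix (Fin g ⊕ Fin g) (Fin g ⊕ Fin g) finAdeleQ) i j ∈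
              FiniteAdeleRing.integralAdeles (𝓞 ℚ) ℚ),
            (GN : Matrix (Fin g ⊕ Fin g) (Fin g ⊕ Fin g) (ZMod N)) i j = integralAdeleResidue N ⟨_, h⟩) →
          ∀ hs : (𝓜.univ.level.twist GN).IsSymplecticLiftable 𝓜.univ.pol δ,
            (haveI := 𝓜.isLocallyNoetherian
             (𝓜.classifyingMap 𝓜.M ({ 𝓜.univ with level := 𝓜.univ.level.twist GN, symplectic := hs } :
               PolarizedAbelianSchemeWithLevel g N δ 𝓜.M.left)).left) ≫ p = p := by
  haveI := 𝓜.isLocallyNoetherian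
  obtain ⟨red, ρ, hred, hker, hρ, hρN, -⟩ := exists_principalLevelSubgroup_one_action δ hδ hg 𝓜
  -- `ρ k` depends only on `red k` (`ker red = K_δ(N)` acts trivially)
  have hfac : ∀ k₁ k₂ : principalLevelSubgroup δ 1, red k₁ = red k₂ → ρ k₁ = ρ k₂ := fun k₁ k₂ h => by
    have h1 : red (k₁⁻¹ * k₂) = 1 := by rw [map_mul, map_inv, h, inv_mul_cancel]
    have h2 : ρ (k₁⁻¹ * k₂) = 1 := hρN _ ((hker _).1 h1)
    rwa [map_mul, map_inv, inv_mul_eq_one] at h2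
  -- the finite image of `K_δ(N₀)` and a choice of preimages
  let K₀ : Subgroup (principalLevelSubgroup δ 1) := (principalLevelSubgroup δ N₀).comap (Subgroup.subtype _)
  let Δ : Subgroup (GL (Fin g ⊕ Fin g) (ZMod N)) := K₀.map red
  have hpre : ∀ x : Δ, ∃ k : principalLevelSubgroup δ 1, k ∈ K₀ ∧ red k = x := fun x => Subgroup.mem_map.1 x.2
  choose lift hliftK hlift using hpre
  have hlift_eq : ∀ (k : principalLevelSubgroup δ 1) (hk : red k ∈ Δ), ρ (lift ⟨red k, hk⟩) = ρ k :=
    fun k hk => hfac _ _ (hlift ⟨red k, hk⟩)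
  let act : Δ →* Aut 𝓜.M :=
    { toFun := fun x => ρ (lift x)
      map_one' := hρN _ ((hker _).1 (by rw [hlift]; rfl))
      map_mul' := fun x y => by
        rw [← map_mul]
        exact hfac _ _ (by rw [hlift, map_mul, hlift, hlift]; rfl) }
  have hact : ∀ x : Δ, act x = ρ (lift x) := fun x => rfl
  have hmemΔ : ∀ k : principalLevelSubgroup δ 1, (k : gspFinAdelic δ) ∈ principalLevelSubgroup δ N₀ → red k ∈ Δ :=
    fun k hk => Subgroup.mem_map.2 ⟨k, hk, rfl⟩
  refine ⟨red, Δ, act, hred, hmemΔ, fun x => ⟨lift x, hliftK x, hlift x⟩, fun k hk => ?_, fun p hinv => ?_⟩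
  · obtain ⟨hs, hρk⟩ := hρ k
    exact ⟨hs, by rw [hact, hlift_eq k hk]; exact hρk⟩
  · refine 𝓜.twist_left_comp_eq_of_forall_inv_left_comp_eq red ρ hred hρ p fun k hk => ?_
    -- `(ρ k)⁻¹ = ρ k⁻¹ = act (red k⁻¹)`, under which `p` is invariant
    have hk' : ((k⁻¹ : principalLevelSubgroup δ 1) : gspFinAdelic δ) ∈ principalLevelSubgroup δ N₀ := inv_mem hk
    have h1 : (ρ k).inv = (ρ k⁻¹).hom := by rw [map_inv]; rfl
    rw [h1, ← hlift_eq k⁻¹ (hmemΔ _ hk'), ← hact]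
    exact hinv _

end SiegelFineModuliScheme

end Literature.AlgebraicGeometry.ModuliOfAbelianVarieties

end
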